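import Mathlib.LinearAlgebra.Matrix.PosDef
import Mathlib.LinearAlgebra.Matrix.NonsingularInverse

/-!
# Gauge change for projection kernels of pinned lattice-Maxwell forms (abstract linear algebra)
# — step (a) of the K1 plan of LINE-18 v5 on crux `BulkMidWindowSU2` (stmt-QuantumFields-24006): planner ym-idea-2 g15's
# `K1-GAUGE-CHANGE-NOTE.md` («K = orthogonal projection onto range d₁, forest-independent») and the Prop `DirProjKernelHodgeForm`
# of the «landau-sector-relative-bl» sketch (HOME ideators/ym-idea-2/l23/Sketch.lean)

Abstract setting (finite index types): an edge set `E`, free coordinates `ι : E_D → E` (the axial/forest gauge keeps only these), a finite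
family of plaquette rows `λ_r : E → ℝ` (`r ∈ plaqs`; restricted rows `λ^D_r = λ_r ∘ ι`), and gauge modes `G_s : E → ℝ` (`s ∈ S`) that are
CURL-FREE (`λ_p · G_s = 0`) and COMPLEMENT the free coordinates (every `u : E → ℝ` is `ext w + Σ_s φ_s G_s` — the forest gauge fixing).
With `Q_D = Σ_r λ^D_r (λ^D_r)ᵀ` positive definite and the HODGE matrix `Q_H = Σ_r λ_r λ_rᵀ + Σ_s G_s G_sᵀ`:
* `hodge_dotProduct_eq` — `v·Q_H v = Σ_r (λ_r·v)² + Σ_s (G_s·v)²`; `hodge_posDef` — `Q_H` is positive definite;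
* `dotProduct_inv_restrict_eq_dotProduct_inv_hodge` — **the gauge change** `λ^D_p · Q_D⁻¹ λ^D_q = λ_p · Q_H⁻¹ λ_q` for all rows `p, q`
  (with `u = Q_H⁻¹λ_q`: curl-freeness kills the gauge part of `Q_H u = λ_q`, so `Σ_r λ_r(λ_r·u) = λ_q`; writing `u = ext w + Σ φ_s G_s`,
  the free coordinates of that identity read `Q_D w = λ^D_q`, whence `λ_p·u = λ^D_p·w = λ^D_p·Q_D⁻¹λ^D_q`).
INSTANTIATION (for the K1 prover): `E` = the cold-box edges inside the enlarged block, `ι` = the inclusion of `DirFree H` (edges off the temporal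
forest), `λ_r = LatticeMaxwell.coeff … r`, `G_x` = lattice gradient of `δ_x` at an interior site `x` (curl-free; the forest decomposition is the
telescoping sum of the temporal components up each interior temporal line); then `boxDirProjKernel H p q = λ_p · Q_H⁻¹ λ_q`
(`DirProjKernelHodgeForm`), i.e. the forest-gauge projection kernel is the Hodge/Landau kernel — gauge independent.
Pure Mathlib, no definition.  HONEST LABEL: an algebraic helper toward step (a) of the open stub K1 of a critic-passed line on the R2ξ″
RECORD-rung crux 24006; no stub, crux, rung or summit is proved; the Yang–Mills mass gap is NOT proved by this.
-/

set_option autoImplicit false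

open Matrix Finset
open scoped Matrix

namespace Summit.QuantumFields.YangMills.Theorems.AllWindowsColdBox.GaugeChange

variable {E : Type*} [Fintype E] [DecidableEq E]

omit [DecidableEq E] in
/-- `(Σ_i a_i a_iᵀ) u = Σ_i (a_i · u) a_i`. -/
theorem sum_vecMulVec_mulVec {ι : Type*} (T : Finset ι) (a : ι → E → ℝ) (u : E → ℝ) :
    (∑ i ∈ T, vecMulVec (a i) (a i)) *ᵥ u = ∑ i ∈ T, (a i ⬝ᵥ u) • a i := by
  rw [Matrix.sum_mulVec]
  refine Finset.sum_congr rfl fun i _ => ?_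
  ext e
  simp only [Matrix.mulVec, vecMulVec_apply, dotProduct, Pi.smul_apply, smul_eq_mul, Finset.sum_mul]
  exact Finset.sum_congr rfl fun j _ => by ring

omit [DecidableEq E] in
/-- `v · (Σ_i a_i a_iᵀ) v = Σ_i (a_i · v)²`. -/
theorem dotProduct_sum_vecMulVec_mulVec {ι : Type*} (T : Finset ι) (a : ι → E → ℝ) (v : E → ℝ) :
    v ⬝ᵥ ((∑ i ∈ T, vecMulVec (a i) (a i)) *ᵥ v) = ∑ i ∈ T, (a i ⬝ᵥ v) ^ 2 := by
  rw [sum_vecMulVec_mulVec, dotProduct_sum]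
  exact Finset.sum_congr rfl fun i _ => by rw [dotProduct_smul, smul_eq_mul, dotProduct_comm, sq]

omit [DecidableEq E] in
/-- `z · (Σ_i c_i • a_i) = Σ_i c_i (z · a_i)`. -/
theorem dotProduct_sum_smul {ι : Type*} (T : Finset ι) (c : ι → ℝ) (a : ι → E → ℝ) (z : E → ℝ) :
    z ⬝ᵥ (∑ i ∈ T, c i • a i) = ∑ i ∈ T, c i * (z ⬝ᵥ a i) := by
  rw [dotProduct_sum]
  exact Finset.sum_congr rfl fun i _ => by rw [dotProduct_smul, smul_eq_mul]

omit [Fintype E] [DecidableEq E] in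
/-- A sum of rank-one Gram terms is symmetric. -/
theorem isHermitian_sum_vecMulVec {ι : Type*} (T : Finset ι) (a : ι → E → ℝ) :
    (∑ i ∈ T, vecMulVec (a i) (a i)).IsHermitian := by
  rw [Matrix.IsHermitian, conjTranspose_eq_transpose_of_trivial, Matrix.transpose_sum]
  exact Finset.sum_congr rfl fun i _ => by rw [Matrix.transpose_vecMulVec]

section Setting

variable {ED S P : Type*} [Fintype ED] [DecidableEq ED] [Fintype S]
variable (ι : ED → E) (plaqs : Finset P) (lam : P → E → ℝ) (G : S → E → ℝ)

omit [DecidableEq ED] in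
/-- A row dotted with the extension by zero of `w` along `ι` is the restricted row dotted with `w`. -/
theorem dotProduct_ext (a : E → ℝ) (w : ED → ℝ) :
    a ⬝ᵥ (fun e : E => ∑ d : ED, if ι d = e then w d else 0) = (fun d : ED => a (ι d)) ⬝ᵥ w := by
  simp only [dotProduct, Finset.mul_sum]
  rw [Finset.sum_comm]
  refine Finset.sum_congr rfl fun d _ => ?_
  rw [Finset.sum_eq_single (ι d)]
  · simp
  · intro e _ hne; simp [Ne.symm hne]
  · intro h; exact absurd (Finset.mem_univ _) h

omit [DecidableEq E] [DecidableEq ED] in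
/-- `v·Q_H v = Σ_r (λ_r·v)² + Σ_s (G_s·v)²`. -/
theorem hodge_dotProduct_eq (v : E → ℝ) :
    v ⬝ᵥ ((∑ r ∈ plaqs, vecMulVec (lam r) (lam r) + ∑ s : S, vecMulVec (G s) (G s)) *ᵥ v) =
      ∑ r ∈ plaqs, (lam r ⬝ᵥ v) ^ 2 + ∑ s : S, (G s ⬝ᵥ v) ^ 2 := by
  rw [Matrix.add_mulVec, dotProduct_add, dotProduct_sum_vecMulVec_mulVec, dotProduct_sum_vecMulVec_mulVec]

omit [DecidableEq ED] in
/-- **The Hodge matrix is positive definite** (curl-free gauge modes complementing positive-definite free coordinates). -/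
theorem hodge_posDef
    (hcurl : ∀ (p : P) (s : S), lam p ⬝ᵥ G s = 0)
    (hdecomp : ∀ u : E → ℝ, ∃ (w : ED → ℝ) (φ : S → ℝ),
      u = (fun e : E => ∑ d : ED, if ι d = e then w d else 0) + ∑ s : S, φ s • G s)
    (hQD : (∑ r ∈ plaqs, vecMulVec (fun d : ED => lam r (ι d)) (fun d : ED => lam r (ι d))).PosDef) :
    (∑ r ∈ plaqs, vecMulVec (lam r) (lam r) + ∑ s : S, vecMulVec (G s) (G s)).PosDef := by
  refine Matrix.PosDef.of_dotProduct_mulVec_pos ?_ fun v hv => ?_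
  · exact (isHermitian_sum_vecMulVec plaqs lam).add (isHermitian_sum_vecMulVec Finset.univ G)
  · simp only [star_trivial]
    rw [hodge_dotProduct_eq]
    have hnn : 0 ≤ ∑ r ∈ plaqs, (lam r ⬝ᵥ v) ^ 2 + ∑ s : S, (G s ⬝ᵥ v) ^ 2 :=
      add_nonneg (Finset.sum_nonneg fun _ _ => sq_nonneg _) (Finset.sum_nonneg fun _ _ => sq_nonneg _)
    rcases hnn.lt_or_eq with hpos | hzero
    · exact hpos
    · exfalso
      apply hv
      -- all curls and all gauge pairings vanish
      have h1 : ∀ r ∈ plaqs, lam r ⬝ᵥ v = 0 := fun r hr => by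
        have := Finset.sum_eq_zero_iff_of_nonneg (fun r _ => sq_nonneg (lam r ⬝ᵥ v)) |>.1
          (by linarith [Finset.sum_nonneg fun s (_ : s ∈ (Finset.univ : Finset S)) => sq_nonneg (G s ⬝ᵥ v),
            Finset.sum_nonneg fun r (_ : r ∈ plaqs) => sq_nonneg (lam r ⬝ᵥ v)]) r hr
        exact pow_eq_zero_iff (n := 2) (by norm_num) |>.1 this
      have h2 : ∀ s : S, G s ⬝ᵥ v = 0 := fun s => by
        have := Finset.sum_eq_zero_iff_of_nonneg (fun s _ => sq_nonneg (G s ⬝ᵥ v)) |>.1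
          (by linarith [Finset.sum_nonneg fun s (_ : s ∈ (Finset.univ : Finset S)) => sq_nonneg (G s ⬝ᵥ v),
            Finset.sum_nonneg fun r (_ : r ∈ plaqs) => sq_nonneg (lam r ⬝ᵥ v)]) s (Finset.mem_univ s)
        exact pow_eq_zero_iff (n := 2) (by norm_num) |>.1 this
      obtain ⟨w, φ, huv⟩ := hdecomp v
      -- the free part vanishes
      have hw : ∀ r ∈ plaqs, (fun d : ED => lam r (ι d)) ⬝ᵥ w = 0 := fun r hr => by
        rw [← dotProduct_ext ι (lam r) w]
        have : lam r ⬝ᵥ v = lam r ⬝ᵥ (fun e : E => ∑ d : ED, if ι d = e then w d else 0) +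
            ∑ s : S, φ s * (lam r ⬝ᵥ G s) := by
          conv_lhs => rw [huv]
          rw [dotProduct_add, dotProduct_sum_smul]
        rw [h1 r hr] at this
        simp only [hcurl, mul_zero, Finset.sum_const_zero, add_zero] at this
        exact this.symm
      have hw0 : w = 0 := by
        by_contra hne
        have hpos := hQD.dotProduct_mulVec_pos hne
        simp only [star_trivial] at hpos
        rw [dotProduct_sum_vecMulVec_mulVec] at hpos
        have : ∑ r ∈ plaqs, ((fun d : ED => lam r (ι d)) ⬝ᵥ w) ^ 2 = 0 :=
          Finset.sum_eq_zero fun r hr => by rw [hw r hr]; ring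
        linarith
      -- hence v is a pure gauge mode orthogonal to all gauge modes
      have hv_gauge : v = ∑ s : S, φ s • G s := by
        rw [huv, hw0]
        ext e; simp
      have hvv : v ⬝ᵥ v = 0 := by
        have hg : v ⬝ᵥ (∑ s : S, φ s • G s) = 0 := by
          rw [dotProduct_sum_smul]
          exact Finset.sum_eq_zero fun s _ => by rw [dotProduct_comm, h2 s, mul_zero]
        calc v ⬝ᵥ v = v ⬝ᵥ (∑ s : S, φ s • G s) := congrArg (v ⬝ᵥ ·) hv_gauge
          _ = 0 := hg
      funext e
      have := Finset.sum_eq_zero_iff_of_nonneg (fun e _ => mul_self_nonneg (v e)) |>.1 (by simpa [dotProduct] using hvv) e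
        (Finset.mem_univ e)
      simpa using this

/-- **Gauge change**: `λ^D_p · Q_D⁻¹ λ^D_q = λ_p · Q_H⁻¹ λ_q` — the forest-gauge projection kernel equals the Hodge/Landau kernel. -/
theorem dotProduct_inv_restrict_eq_dotProduct_inv_hodge
    (hcurl : ∀ (p : P) (s : S), lam p ⬝ᵥ G s = 0)
    (hdecomp : ∀ u : E → ℝ, ∃ (w : ED → ℝ) (φ : S → ℝ),
      u = (fun e : E => ∑ d : ED, if ι d = e then w d else 0) + ∑ s : S, φ s • G s)
    (hQD : (∑ r ∈ plaqs, vecMulVec (fun d : ED => lam r (ι d)) (fun d : ED => lam r (ι d))).PosDef) (p q : P) :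
    (fun d : ED => lam p (ι d)) ⬝ᵥ
        ((∑ r ∈ plaqs, vecMulVec (fun d : ED => lam r (ι d)) (fun d : ED => lam r (ι d)))⁻¹ *ᵥ fun d : ED => lam q (ι d)) =
      lam p ⬝ᵥ ((∑ r ∈ plaqs, vecMulVec (lam r) (lam r) + ∑ s : S, vecMulVec (G s) (G s))⁻¹ *ᵥ lam q) := by
  set QD := ∑ r ∈ plaqs, vecMulVec (fun d : ED => lam r (ι d)) (fun d : ED => lam r (ι d)) with hQDdef
  set QH := ∑ r ∈ plaqs, vecMulVec (lam r) (lam r) + ∑ s : S, vecMulVec (G s) (G s) with hQHdef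
  have hQH : QH.PosDef := hodge_posDef ι plaqs lam G hcurl hdecomp hQD
  -- u = Q_H⁻¹ λ_q solves Q_H u = λ_q
  set u := QH⁻¹ *ᵥ lam q with hu
  have hdetH : IsUnit QH.det := (Matrix.isUnit_iff_isUnit_det QH).1 hQH.isUnit
  have hQHu : QH *ᵥ u = lam q := by
    rw [hu, Matrix.mulVec_mulVec, Matrix.mul_nonsing_inv QH hdetH, Matrix.one_mulVec]
  -- expand Q_H u
  have hexp : ∑ r ∈ plaqs, (lam r ⬝ᵥ u) • lam r + ∑ s : S, (G s ⬝ᵥ u) • G s = lam q := by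
    rw [← hQHu, hQHdef, Matrix.add_mulVec, sum_vecMulVec_mulVec, sum_vecMulVec_mulVec]
  -- the gauge part z = Σ_s (G_s·u) G_s vanishes: it is orthogonal to every row and to λ_q
  set z := ∑ s : S, (G s ⬝ᵥ u) • G s with hz
  have hz_row : ∀ r : P, z ⬝ᵥ lam r = 0 := fun r => by
    rw [hz, dotProduct_comm, dotProduct_sum_smul]
    exact Finset.sum_eq_zero fun s _ => by rw [hcurl, mul_zero]
  have hzA : z = lam q - ∑ r ∈ plaqs, (lam r ⬝ᵥ u) • lam r := by rw [← hexp]; abel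
  have hzz : z ⬝ᵥ z = 0 := by
    calc z ⬝ᵥ z = z ⬝ᵥ (lam q - ∑ r ∈ plaqs, (lam r ⬝ᵥ u) • lam r) := congrArg (z ⬝ᵥ ·) hzA
      _ = 0 := by
          rw [dotProduct_sub, hz_row, dotProduct_sum_smul]
          simp [hz_row]
  have hz0 : z = 0 := by
    funext e
    have := Finset.sum_eq_zero_iff_of_nonneg (fun e _ => mul_self_nonneg (z e)) |>.1 (by simpa [dotProduct] using hzz) e
      (Finset.mem_univ e)
    simpa using this
  have hcurlEq : ∑ r ∈ plaqs, (lam r ⬝ᵥ u) • lam r = lam q := by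
    have := hexp; rw [hz0, add_zero] at this; exact this
  -- forest decomposition of u
  obtain ⟨w, φ, huw⟩ := hdecomp u
  have hrow_u : ∀ r : P, lam r ⬝ᵥ u = (fun d : ED => lam r (ι d)) ⬝ᵥ w := fun r => by
    rw [huw, dotProduct_add, dotProduct_ext, dotProduct_sum_smul]
    simp [hcurl]
  -- the free coordinates of `Σ_r (λ_r·u) λ_r = λ_q` say `Q_D w = λ^D_q`
  have hQDw : QD *ᵥ w = fun d : ED => lam q (ι d) := by
    rw [hQDdef, sum_vecMulVec_mulVec]
    funext d
    have := congr_fun hcurlEq (ι d)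
    simp only [Finset.sum_apply, Pi.smul_apply, smul_eq_mul] at this ⊢
    rw [← this]
    exact Finset.sum_congr rfl fun r _ => by rw [hrow_u r]
  have hdetD : IsUnit QD.det := (Matrix.isUnit_iff_isUnit_det QD).1 hQD.isUnit
  have hw : QD⁻¹ *ᵥ (fun d : ED => lam q (ι d)) = w := by
    rw [← hQDw, Matrix.mulVec_mulVec, Matrix.nonsing_inv_mul QD hdetD, Matrix.one_mulVec]
  -- conclude
  rw [hw, ← hrow_u p]

end Setting

end Summit.QuantumFields.YangMills.Theorems.AllWindowsColdBox.GaugeChange
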